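import Summits.CriticalPhenomena.PercolationContinuityZ3.Theorems.PercNearOneGluingNoHeavyLowerTailHullPortTAInduction
import Literature.Probability.Percolation.ClusterConditionalCovariance
import HarnessLib

/-!
# `NoHeavyLowerTail` (stmt-CriticalPhenomena-4575) — hull-port line: Lemma `P_v` (hypothesis `hPv`) discharged from the Literature

Support file (provers `prim-ineq-prove-5` / `prim-lit-3`; `--supports stmt-CriticalPhenomena-4575`); no definitions, named facts or sorries.
Independent of `…HullPortTACE.lean` (`HullPort.selection_triple`, via (CE) and prim-hp-7's `MarkerDominancePv.sum_condSumW_ge`):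
The last hypothesis `hPv` (prim-hp-7's Lemma `P_v`, HP7-MDLX-PROOF.md §1) of `HullPort.selection_triple_of_Pv`
(`…HullPortTAInduction.lean`) is DISCHARGED by the Literature theorem
`Literature.Probability.Percolation.ClusterConditioning.clusterConditioning_cov_le'`
(`Literature/Probability/Percolation/ClusterConditionalCovariance.lean`: Gladkov 2024 Thm 3.2 for the cluster
exploration + Lemma 3.1 + van den Berg–Häggström–Kahn Thm 1.3, all proved), so the selection lemma SL(3,1)
holds unconditionally.
* `HullPort.Pv_holds` — Lemma `P_v` in the letter of `hPv`;
* (SL(3,1) itself is `HullPort.selection_triple` in `…HullPortTACE.lean`; `selection_triple_of_Pv … (Pv_holds x₂ x₃)` is a second proof of the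
  same statement and is not restated.)  `Pv_holds` also feeds `HullPort.TA_of_Pv` / `markerDominanceAvoid_of_Pv` (general monotone `g ≥ 0`).
[cite: Gladkov2024, Thm. 3.2 (p. 4); VandenbergHaggstromKahn2005, Thm. 1.3 (p. 6) — corollaries]
-/

noncomputable section

namespace Summit.CriticalPhenomena.PercolationContinuityZ3.Theorems

open MeasureTheory Set Literature.Probability.LatticeModels Literature.Probability.Percolation
open scoped Classical

variable {V : Type*} [Fintype V]

namespace HullPort

open BHK2006 DecisionTree Literature.Probability.Percolation.ClusterConditioning

/-- **Lemma `P_v` holds**: the hypothesis `hPv` of `HullPort.selection_triple_of_Pv` / `HullPort.TA_of_Pv`, from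
`ClusterConditioning.clusterConditioning_cov_le'` by unfolding `taB`, `taC`, `delE`, `cut`, `avoidEv`.
[cite: Gladkov2024, Thm. 3.2 (p. 4); VandenbergHaggstromKahn2005, Thm. 1.3 (p. 6) — corollary] -/
theorem Pv_holds (s y : V) :
    ∀ g : Set (Sym2 V) → ℝ, Monotone g → (∀ C, 0 ≤ g C) →
      ∀ (q : Sym2 V → unitInterval), (∀ e, (q e : ℝ) < 1) → ∀ v' : V,
      taB (fun e => (q e : ℝ)) s y {v'} g ≤
        (1 - delE (fun e => (q e : ℝ)) ∅ (ind ((openConn s y : Set (BondConfig V))ᶜ ∩ openConn y v')) /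
              delE (fun e => (q e : ℝ)) ∅ (ind (openConn s y : Set (BondConfig V))ᶜ)) *
          (delE (fun e => (q e : ℝ)) ∅ (fun η => g (openEdgeCluster η s) * ind (openConn s y) η) -
            delE (fun e => (q e : ℝ)) ∅ (fun η => g (openEdgeCluster η s)) *
              delE (fun e => (q e : ℝ)) ∅ (ind (openConn s y))) := by
  intro g hg hg0 q _ v'
  have h := clusterConditioning_cov_le' q s y v' g hg hg0
  simp only [taB, taC, delE, cut, avoidEv]
  exact h

end HullPort

end Summit.CriticalPhenomena.PercolationContinuityZ3.Theorems

end
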